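import Literature.MathematicalPhysics.QuantumLattice.TypeClassSidecarReaderFillingBoxParticleHole
import Literature.MathematicalPhysics.QuantumLattice.MarkovCertificateParticleHole
import HarnessLib

/-!
# The electron-doped 3-cell sidecar reader with the hot Markov anchor READ AT THE REFLECTED CHEMICAL POTENTIAL `U₀ − μ`

Family `hubbard` (topic `MathematicalPhysics/QuantumLattice`), seat hubbard-downfold-unc-2 (FILLING / particle–hole direction of «a parameter BOX
maps to a certified word»; electron-doped half), 2026-08-27.

`TypeClassSidecarReaderFillingBoxParticleHole` §2 words an electron-doped `(t', U, n)`-cell from ONE hole-doped sidecar read on its reflected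
skeleton (cold input, `c2Check`ed types) and ONE `t' = 0` corner Markov certificate at `(β_h, μ, U₀)` (hot input), the latter through the Legendre
step `−β_h μ n` — loose on the electron side when the certificate is hole-tuned (`μ < U₀/2`). `MarkovCertificateParticleHole` (this seat) reflects
the certificate to `U₀ − μ` inside Lean (same blocks; every torus); this file is the composition:

* `IsTorusLimitOfMixture.meanEnergy_hubbardTTPrime_le_of_c2Check₂_particleHole_of_cornerMarkovCertificate_particleHole_tPrimeUBox_allTori_anchorU_kinematic`
  (generic corner window) and the rectangle / row-file edition `…_of_rectMarkovCertificate_particleHole_…'` (`16/π² ↦ 16212/10000`):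
  the §2 bound with `(c − β_h μ n)` replaced by `((c + β_h(U₀ − 2μ)) − β_h(U₀ − μ) n)`, i.e. lowered by `β_h(U₀ − 2μ)(n − 1)` for `n > 1`.

Everything is PROVED; no definition, no named fact, no number. HONEST SCOPE: exact symmetry transport of an existing certificate; the cold input,
the `t'`-transport prices and the kinematic `U`-prices are unchanged. WHAT THIS IS NOT: no certificate, no phase sentence.

## Mathlib / tree search

REUSED: `eventually_pressureFloor_chord_of_c2Check₂_particleHole_of_mem_Icc` (`TypeClassSidecarReaderFillingBoxParticleHole` §1),
`eventually_mul_sq_le_log_partitionFn_sector_of_tPrime_anchor_floor` (`TypeClassSidecarReaderTPrimeTransport`),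
`eventually_log_partitionFn_sector_le_of_cornerMarkovCertificate_particleHole_tPrimeTransport` (`MarkovCertificateParticleHole` §4),
`IsTorusLimitOfMixture.meanEnergy_hubbardTTPrime_le_of_pressure_bounds_anchorU_kinematic` (`HubbardTTPrimePressureFloorUTransport`),
`c2Check_sound`, rectangle bookkeeping. `rg 'c2Check₂_particleHole_of_.*particleHole' Literature` (2026-08-27): nothing.

## References

* E. H. Lieb, Phys. Rev. Lett. 62 (1989) 1201, proof of Theorem 2. [cite: LiebPRL1989, proof of Theorem 2]
* E. H. Lieb, F. Y. Wu, Physica A 321 (2003) 1, §1 eq. (3). [cite: LiebWuPhysicaA2003, §1 eq. (3)]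
* R. B. Israel, *Convexity in the Theory of Lattice Gases* (1979), Lemma II.3.1. [cite: Israel1979, Lemma II.3.1]
* D. Ruelle, *Statistical Mechanics: Rigorous Results* (1969), §3.3. [cite: Ruelle1969, §3.3 (3.11)–(3.18)]
* D. Poulin, M. B. Hastings, Phys. Rev. Lett. 106 (2011) 080403, eqs. (3)–(8). [cite: PoulinHastings2011, eqs. (3)–(8)]
-/

noncomputable section

namespace Literature.MathematicalPhysics.QuantumLattice

open Matrix Finset HubbardWave0 ThermodynamicLimit LiebThm1 AndersonCluster Literature.Probability.LatticeModels
open _root_.Filter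
open scoped _root_.Topology ComplexOrder BigOperators

namespace InfVolFermionState

variable {t s U n β : ℝ} {ω : InfVolFermionState 2} {Ls : ℕ → ℕ}

/-- **ELECTRON-DOPED `(t', U, n)`-CELL from ONE hole-doped sidecar (of `H^open(t, sh, U₀)`), TWO checked types on its reflected skeleton, and a
`t' = 0` CORNER Markov certificate at `(β_h, μ, U₀)` READ AT `U₀ − μ`**; for every torus limit of `H(t, s, U)` at `(β, n)` with `|s| ≤ σ₁`,
`|s − (−sh)| ≤ σ₂`, `ρ₁ ≤ n ≤ ρ₂` (`n < 2`, `0 < β_h < β`), along ANY `Ls → ∞` (no parity condition):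
`e_Φ(ω) ≤ (((((c + β_h(U₀ − 2μ)) − β_h(U₀ − μ)n) + β_hσ₁16/π²) + β_h·max(U₀−U,0)·n/2) − ((((W₁ + (n−ρ₁)/(ρ₂−ρ₁)(W₂−W₁)) + βU₀(1−n)) − βσ₂16/π²) − β·max(U−U₀,0)·n/2))/(β−β_h)`.
[cite: LiebPRL1989, proof of Theorem 2] [cite: LiebWuPhysicaA2003, §1 eq. (3)] [cite: Israel1979, Lemma II.3.1] [cite: Ruelle1969, §3.3 (3.11)–(3.18)]
[cite: PoulinHastings2011, eqs. (3)–(8)] -/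
theorem IsTorusLimitOfMixture.meanEnergy_hubbardTTPrime_le_of_c2Check₂_particleHole_of_cornerMarkovCertificate_particleHole_tPrimeUBox_allTori_anchorU_kinematic
    (hn2 : n < 2) (sh : ℝ) {σ₁ σ₂ : ℝ} (hσ₁ : |s| ≤ σ₁) (hσ₂ : |s - (-sh)| ≤ σ₂) (U₀ : ℝ)
    (h : ω.IsTorusLimitOfMixture (sectorGibbsCount n) (fun L => sectorGibbsWeightTT' β t s U n L)
      (fun L => sectorGibbsVectorTT' t s U n L) Ls)
    (hLs : Tendsto Ls atTop atTop) {βh : ℝ} (hβh : 0 < βh) (hlt : βh < β)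
    -- C2: hole-doped sidecar of `H^open(t, sh, U₀)`, two checked types on the reflected skeleton
    {a b : ℕ} (ha : 1 ≤ a) (hb : 1 ≤ b) {rows₁ rows₂ : List C2Row} {P₁ K₁ P₂ K₂ q₁ q₂ A₁ A₂ : ℕ}
    {W₁num W₂num : ℤ} {W₁den W₂den : ℕ}
    (h₁ : c2Check P₁ K₁ q₁ A₁ a b rows₁ W₁num W₁den = true) (h₂ : c2Check P₂ K₂ q₂ A₂ a b rows₂ W₂num W₂den = true)
    (hskel : rows₁.map (fun r => (r.sec, r.zn, r.ze)) = rows₂.map (fun r => (r.sec, r.zn, r.ze)))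
    (hsec : ∀ r ∈ rows₁, r.nu ≤ a * b ∧ r.nd ≤ a * b)
    {ρ₁ ρ₂ : ℝ} (hρ₁ : ρ₁ * ((q₁ : ℝ) * a * b) = 2 * A₁) (hρ₂ : ρ₂ * ((q₂ : ℝ) * a * b) = 2 * A₂) (hρ : ρ₁ < ρ₂)
    (hn1 : ρ₁ ≤ n) (hn2' : n ≤ ρ₂)
    (hnode : ∀ r ∈ rows₁, r.floor ≤
      (partitionFn β (spinSectorHamiltonian (a * b - r.nu) (a * b - r.nd) (hubbardOpenBoxTT' a b t sh U₀))).re)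
    -- C1 (corner window, `t' = 0`) at `(βh, μ, U₀)`, to be read at `U₀ − μ`
    (μ : ℝ) {Λ : Finset (Site 2)} {x₀ : Site 2} (hx₀ : x₀ ∈ Λ) (hmax : ∀ y ∈ Λ, toLex y ≤ toLex x₀)
    (hcorner : ∀ i : Fin 2, x₀ - unitVec i ∈ Λ) {ℓw : ℕ} (hΛ : Λ ⊆ halfOpenBox 2 ℓw)
    {ι : Type*} (sι : Finset ι) (Sw : ι → Finset (Site 2)) (hS : ∀ i, Sw i ⊆ Λ) (zw : ι → Site 2)
    (hzw : ∀ i, shiftSet (zw i) (Sw i) ⊆ Λ) {O : ∀ i, FermionOp (Sw i)} (hO : ∀ i ∈ sι, (O i).IsHermitian)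
    (g : ι → ℝ) {LB : FermionOp (Λ.erase x₀)} (hLB : LB.IsHermitian) {c : ℝ}
    (hcert : ((Real.exp c : ℂ) • cfc Real.exp LB -
      fermionPartialTrace (PolySite.incl (Finset.erase_subset x₀ Λ))
        (cfc Real.exp (-((βh : ℂ) • (cornerEnergyRep Λ x₀ t U₀ μ + windowAnnihilator sι Λ Sw hS zw hzw O g)) +
          fermionEmbed (PolySite.incl (Finset.erase_subset x₀ Λ)) LB))).PosSemidef) :
    ω.meanEnergy (hubbardTTPrimeFermionInteraction t s U) 1 ≤
      (((((c + βh * (U₀ - 2 * μ)) - βh * (U₀ - μ) * n) + βh * σ₁ * (16 / Real.pi ^ 2)) + βh * max (U₀ - U) 0 * (n / 2)) -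
        ((((((W₁num : ℝ) / W₁den) + (n - ρ₁) / (ρ₂ - ρ₁) * (((W₂num : ℝ) / W₂den) - ((W₁num : ℝ) / W₁den))) +
            β * U₀ * (1 - n)) - β * σ₂ * (16 / Real.pi ^ 2)) - β * max (U - U₀) 0 * (n / 2))) / (β - βh) := by
  obtain ⟨-, hq₁, -⟩ := c2Check_sound h₁ ha hb
  have hn0 : 0 ≤ n := by
    have hq₁r : (0 : ℝ) < q₁ := by exact_mod_cast hq₁
    have har : (0 : ℝ) < a := by exact_mod_cast ha
    have hbr : (0 : ℝ) < b := by exact_mod_cast hb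
    have hpos : 0 < (q₁ : ℝ) * a * b := by positivity
    have hA : (0 : ℝ) ≤ 2 * A₁ := by positivity
    have hρ₁0 : 0 ≤ ρ₁ := (mul_nonneg_iff_of_pos_right hpos).1 (by rw [hρ₁]; exact hA)
    linarith
  have hβ : 0 < β := hβh.trans hlt
  have hK0 : 0 ≤ 16 / Real.pi ^ 2 := by positivity
  set Wc : ℝ := (((W₁num : ℝ) / W₁den) + (n - ρ₁) / (ρ₂ - ρ₁) * (((W₂num : ℝ) / W₂den) - ((W₁num : ℝ) / W₁den))) +
    β * U₀ * (1 - n) with hWc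
  -- cold input at `(β, t, −sh, U₀)`: the reflected chord floor, then transported along `t'`
  have hW0 : ∀ ε : ℝ, 0 < ε → ∀ᶠ j in atTop,
      (Wc - ε) * (Ls j : ℝ) ^ 2 ≤ Real.log (partitionFn β (sectorHamiltonianTT' t (-sh) U₀ n (Ls j))).re :=
    fun ε hε => eventually_pressureFloor_chord_of_c2Check₂_particleHole_of_mem_Icc t sh U₀ n hβ.le ha hb h₁ h₂ hskel hsec
      hρ₁ hρ₂ hρ hn1 hn2' hn2 hnode hLs hε
  have hWs := eventually_mul_sq_le_log_partitionFn_sector_of_tPrime_anchor_floor hn0 hn2 t U₀ hβ (-sh) s hLs hW0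
  have hWs' : ∀ ε : ℝ, 0 < ε → ∀ᶠ j in atTop,
      ((Wc - β * σ₂ * (16 / Real.pi ^ 2)) - ε) * (Ls j : ℝ) ^ 2 ≤
        Real.log (partitionFn β (sectorHamiltonianTT' t s U₀ n (Ls j))).re := by
    intro ε hε
    filter_upwards [hWs ε hε] with j hj
    refine le_trans (mul_le_mul_of_nonneg_right ?_ (sq_nonneg _)) hj
    have h2 : β * |s - (-sh)| * (16 / Real.pi ^ 2) ≤ β * σ₂ * (16 / Real.pi ^ 2) :=
      mul_le_mul_of_nonneg_right (mul_le_mul_of_nonneg_left hσ₂ hβ.le) hK0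
    linarith
  -- hot input at `(βh, t, s, U₀)`: the corner C1 REFLECTED to `U₀ − μ`, transported along `t'`
  have hu := eventually_log_partitionFn_sector_le_of_cornerMarkovCertificate_particleHole_tPrimeTransport hn0 hn2 t s U₀ hβh hLs μ
    hx₀ hmax hcorner hΛ sι Sw hS zw hzw hO g hLB hcert
  have hu' : ∀ ε : ℝ, 0 < ε → ∀ᶠ j in atTop,
      Real.log (partitionFn βh (sectorHamiltonianTT' t s U₀ n (Ls j))).re ≤
        ((((c + βh * (U₀ - 2 * μ)) - βh * (U₀ - μ) * n) + βh * σ₁ * (16 / Real.pi ^ 2)) + ε) * (Ls j : ℝ) ^ 2 := by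
    intro ε hε
    filter_upwards [hu ε hε] with j hj
    refine hj.trans (mul_le_mul_of_nonneg_right ?_ (sq_nonneg _))
    have h1 : βh * |s| * (16 / Real.pi ^ 2) ≤ βh * σ₁ * (16 / Real.pi ^ 2) :=
      mul_le_mul_of_nonneg_right (mul_le_mul_of_nonneg_left hσ₁ hβh.le) hK0
    linarith
  exact h.meanEnergy_hubbardTTPrime_le_of_pressure_bounds_anchorU_kinematic hn0 hn2.le U₀ hLs hβh hlt hWs' hu'

/-- **Rectangle corollary, row-file edition** (`Λ = rectWindow a' b'`, corner `(a' − 1, b' − 1)`, `a', b' ≥ 2`; `16/π²` replaced by `16212/10000`) of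
the electron-doped 3-cell reader with the REFLECTED hot anchor.
[cite: LiebPRL1989, proof of Theorem 2] [cite: LiebWuPhysicaA2003, §1 eq. (3)] [cite: Israel1979, Lemma II.3.1] [cite: PoulinHastings2011, eqs. (3)–(8)] -/
theorem IsTorusLimitOfMixture.meanEnergy_hubbardTTPrime_le_of_c2Check₂_particleHole_of_rectMarkovCertificate_particleHole_tPrimeUBox_allTori_anchorU_kinematic'
    (hn2 : n < 2) (sh : ℝ) {σ₁ σ₂ : ℝ} (hσ₁ : |s| ≤ σ₁) (hσ₂ : |s - (-sh)| ≤ σ₂) (U₀ : ℝ)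
    (h : ω.IsTorusLimitOfMixture (sectorGibbsCount n) (fun L => sectorGibbsWeightTT' β t s U n L)
      (fun L => sectorGibbsVectorTT' t s U n L) Ls)
    (hLs : Tendsto Ls atTop atTop) {βh : ℝ} (hβh : 0 < βh) (hlt : βh < β)
    {a b : ℕ} (ha : 1 ≤ a) (hb : 1 ≤ b) {rows₁ rows₂ : List C2Row} {P₁ K₁ P₂ K₂ q₁ q₂ A₁ A₂ : ℕ}
    {W₁num W₂num : ℤ} {W₁den W₂den : ℕ}
    (h₁ : c2Check P₁ K₁ q₁ A₁ a b rows₁ W₁num W₁den = true) (h₂ : c2Check P₂ K₂ q₂ A₂ a b rows₂ W₂num W₂den = true)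
    (hskel : rows₁.map (fun r => (r.sec, r.zn, r.ze)) = rows₂.map (fun r => (r.sec, r.zn, r.ze)))
    (hsec : ∀ r ∈ rows₁, r.nu ≤ a * b ∧ r.nd ≤ a * b)
    {ρ₁ ρ₂ : ℝ} (hρ₁ : ρ₁ * ((q₁ : ℝ) * a * b) = 2 * A₁) (hρ₂ : ρ₂ * ((q₂ : ℝ) * a * b) = 2 * A₂) (hρ : ρ₁ < ρ₂)
    (hn1 : ρ₁ ≤ n) (hn2' : n ≤ ρ₂)
    (hnode : ∀ r ∈ rows₁, r.floor ≤
      (partitionFn β (spinSectorHamiltonian (a * b - r.nu) (a * b - r.nd) (hubbardOpenBoxTT' a b t sh U₀))).re)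
    (μ : ℝ) {a' b' : ℕ} (ha' : 2 ≤ a') (hb' : 2 ≤ b')
    {ι : Type*} (sι : Finset ι) (Sw : ι → Finset (Site 2)) (hS : ∀ i, Sw i ⊆ rectWindow a' b') (zw : ι → Site 2)
    (hzw : ∀ i, shiftSet (zw i) (Sw i) ⊆ rectWindow a' b') {O : ∀ i, FermionOp (Sw i)}
    (hO : ∀ i ∈ sι, (O i).IsHermitian) (g : ι → ℝ)
    {LB : FermionOp ((rectWindow a' b').erase (mkSite2 (a' - 1) (b' - 1)))} (hLB : LB.IsHermitian) {c : ℝ}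
    (hcert : ((Real.exp c : ℂ) • cfc Real.exp LB -
      fermionPartialTrace (PolySite.incl (Finset.erase_subset (mkSite2 (a' - 1) (b' - 1)) (rectWindow a' b')))
        (cfc Real.exp (-((βh : ℂ) • (cornerEnergyRep (rectWindow a' b') (mkSite2 (a' - 1) (b' - 1)) t U₀ μ +
            windowAnnihilator sι (rectWindow a' b') Sw hS zw hzw O g)) +
          fermionEmbed (PolySite.incl (Finset.erase_subset (mkSite2 (a' - 1) (b' - 1)) (rectWindow a' b'))) LB))).PosSemidef) :
    ω.meanEnergy (hubbardTTPrimeFermionInteraction t s U) 1 ≤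
      (((((c + βh * (U₀ - 2 * μ)) - βh * (U₀ - μ) * n) + βh * σ₁ * (16212 / 10000)) + βh * max (U₀ - U) 0 * (n / 2)) -
        ((((((W₁num : ℝ) / W₁den) + (n - ρ₁) / (ρ₂ - ρ₁) * (((W₂num : ℝ) / W₂den) - ((W₁num : ℝ) / W₁den))) +
            β * U₀ * (1 - n)) - β * σ₂ * (16212 / 10000)) - β * max (U - U₀) 0 * (n / 2))) / (β - βh) := by
  have hmain := h.meanEnergy_hubbardTTPrime_le_of_c2Check₂_particleHole_of_cornerMarkovCertificate_particleHole_tPrimeUBox_allTori_anchorU_kinematic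
    hn2 sh hσ₁ hσ₂ U₀ hLs hβh hlt ha hb h₁ h₂ hskel hsec hρ₁ hρ₂ hρ hn1 hn2' hnode μ
    (rectCorner_mem_rectWindow (by omega) (by omega)) toLex_le_toLex_rectCorner (rectCorner_sub_unitVec_mem_rectWindow ha' hb')
    (rectWindow_subset_halfOpenBox_max a' b') sι Sw hS zw hzw hO g hLB hcert
  refine hmain.trans (div_le_div_of_nonneg_right ?_ (by linarith))
  have hK := sixteen_div_pi_sq_lt.le
  have hσ₁0 : 0 ≤ σ₁ := (abs_nonneg s).trans hσ₁
  have hσ₂0 : 0 ≤ σ₂ := (abs_nonneg _).trans hσ₂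
  have h1 := mul_le_mul_of_nonneg_left hK (mul_nonneg hβh.le hσ₁0)
  have h2 := mul_le_mul_of_nonneg_left hK (mul_nonneg (hβh.trans hlt).le hσ₂0)
  linarith

end InfVolFermionState

end Literature.MathematicalPhysics.QuantumLattice
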